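import Mathlib
import HarnessLib

/-!
# Enflo 2023, v2 (44)–(45) and p.20: the total budget of the Main Construction and the small-`L` admissibility

Source under adjudication: Per H. Enflo, *On the invariant subspace problem in Hilbert spaces*, arXiv:2305.15442 (v1
2023, v2 2024), bib key `Enflo2023` — a CLAIMED proof of the invariant subspace problem for operators on a separable
Hilbert space.  This file is part of the kernel-tight typing of the manuscript by the b2b-enflo repair cell
(formaliser 2, Part B: (28)–(47), the limiting argument and the final deduction).  It records what FOLLOWS (proved
implications from the manuscript's displayed hypotheses) and, where a step does not follow, the typed inference
together with its refutation.  NOTHING here asserts that the manuscript's main theorem holds; no declaration concludes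
the invariant subspace problem for an arbitrary operator.  Value (BLOCK-2b): theorems / refutations of typed
inferences about a text — not progress on the problem.

Two pieces of bookkeeping that DO follow (they are used as hypotheses of `RoomClaim` and of the type-2 threshold):
* v2 p.19–20, after (45) (LaTeX l.650): "by (45) [each MC step changes `⟨[ ]⁻¹x₀, x₀⟩` by at most `10β·εθ`] and the
  step just described [`εθ` decreases by the factor `(1 − β)`], it is possible … to get down to arbitrarily small `εθ`'s
  without changing `⟨[ ]⁻¹x₀, x₀⟩` more than a total of `10(εθ)₀`."  Typed: if `0 ≤ (εθ)_{n+1} ≤ (1 − β)(εθ)_n` then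
  `Σ_{n<N} 10β(εθ)_n ≤ 10((εθ)₀ − (εθ)_N) ≤ 10(εθ)₀` for every `N` (`sum_step_budget_le`), hence also for the full series
  (`tsum_step_budget_le`).  The per-step bound (45) itself is a first-order claim and is NOT asserted here.
* v2 p.20 bottom (LaTeX l.692–695): "`L₀ > 0`: if `‖ℓ'(T)y₀' − x₀‖ ≤ 0.2` then `‖ℓ'(T)(y₀' + Ls_n) − x₀‖ < 0.3` if
  `L < 0.1/(D‖ℓ'(T)‖)`" (`‖s_n‖ ≤ D`).  Typed with the operator norm of `A = ℓ'(T)` (the paper writes `‖ℓ'‖₂`, which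
  dominates `‖ℓ'(T)‖_op` up to the factor `(1 − ‖T‖²)^{-1/2} ≈ 1` for `‖T‖ = 10⁻²⁰`): `smallL_admissible`.
-/

open scoped InnerProductSpace
open Finset

namespace Literature.Analysis.OperatorTheory.Enflo2023

/-- (44)–(45) ⇒ total budget: if `(εθ)_{n+1} ≤ (1 − β)(εθ)_n` and `(εθ)_n ≥ 0`, the per-step allowances
`10β(εθ)_n` sum to at most `10((εθ)₀ − (εθ)_N) ≤ 10(εθ)₀` (telescoping: `β(εθ)_n ≤ (εθ)_n − (εθ)_{n+1}`).
[cite: Enflo2023, v2 (45), p.19–20] -/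
theorem sum_step_budget_le (εθ : ℕ → ℝ) (β : ℝ) (hpos : ∀ n, 0 ≤ εθ n)
    (hstep : ∀ n, εθ (n + 1) ≤ (1 - β) * εθ n) (N : ℕ) :
    ∑ n ∈ range N, 10 * β * εθ n ≤ 10 * εθ 0 := by
  have h1 : ∀ n, 10 * β * εθ n ≤ 10 * (εθ n - εθ (n + 1)) := by
    intro n; nlinarith [hstep n]
  calc ∑ n ∈ range N, 10 * β * εθ n ≤ ∑ n ∈ range N, 10 * (εθ n - εθ (n + 1)) := sum_le_sum fun n _ => h1 n
    _ = 10 * (εθ 0 - εθ N) := by rw [← mul_sum, sum_range_sub']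
    _ ≤ 10 * εθ 0 := by nlinarith [hpos N]

/-- The same for the whole series (`0 ≤ β`): `Σ_n 10β(εθ)_n ≤ 10(εθ)₀`. [cite: Enflo2023, v2 (45), p.19–20] -/
theorem tsum_step_budget_le (εθ : ℕ → ℝ) (β : ℝ) (hβ : 0 ≤ β) (hpos : ∀ n, 0 ≤ εθ n)
    (hstep : ∀ n, εθ (n + 1) ≤ (1 - β) * εθ n) :
    ∑' n, 10 * β * εθ n ≤ 10 * εθ 0 :=
  Real.tsum_le_of_sum_range_le (fun n => by have := hpos n; positivity)
    (sum_step_budget_le εθ β hpos hstep)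

variable {H : Type*} [NormedAddCommGroup H] [InnerProductSpace ℂ H]

/-- p.20 bottom, "`L₀ > 0`": with `A = ℓ'(T)`, `‖A y₀ − x₀‖ ≤ 0.2`, `‖s‖ ≤ D` and `0 ≤ L`, `L·D·‖A‖ < 0.1`, the
perturbed start is still admissible: `‖A(y₀ + L s) − x₀‖ < 0.3`. [cite: Enflo2023, v2 p.20] -/
theorem smallL_admissible (A : H →L[ℂ] H) (x₀ y₀ s : H) (D L : ℝ) (hD : ‖s‖ ≤ D)
    (hy : ‖A y₀ - x₀‖ ≤ 0.2) (hL0 : 0 ≤ L) (hL : L * (D * ‖A‖) < 0.1) :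
    ‖A (y₀ + (L : ℂ) • s) - x₀‖ < 0.3 := by
  have hsplit : A (y₀ + (L : ℂ) • s) - x₀ = (A y₀ - x₀) + (L : ℂ) • A s := by
    rw [map_add, map_smul]; abel
  have hAs : ‖A s‖ ≤ ‖A‖ * D := (A.le_opNorm s).trans (mul_le_mul_of_nonneg_left hD (norm_nonneg _))
  have hLs : ‖(L : ℂ) • A s‖ ≤ L * (D * ‖A‖) := by
    rw [norm_smul, Complex.norm_real, Real.norm_of_nonneg hL0]
    exact mul_le_mul_of_nonneg_left (by linarith [hAs, mul_comm ‖A‖ D]) hL0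
  calc ‖A (y₀ + (L : ℂ) • s) - x₀‖ = ‖(A y₀ - x₀) + (L : ℂ) • A s‖ := by rw [hsplit]
    _ ≤ ‖A y₀ - x₀‖ + ‖(L : ℂ) • A s‖ := norm_add_le _ _
    _ < 0.3 := by linarith

end Literature.Analysis.OperatorTheory.Enflo2023
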